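import Literature.Analysis.Complex.GraphContourDeformation
import Literature.Analysis.FunctionSpaces.Complexify
import Mathlib.MeasureTheory.Measure.Haar.InnerProductSpace
import Mathlib.MeasureTheory.Constructions.Pi
import Mathlib.MeasureTheory.Integral.Prod
import HarnessLib

/-!
# Deformation of `ℝ^{n+1}` into a graph along the first coordinate

Topic `Literature/Analysis/Complex` (contour integration in several variables). The
several-variable companion of `GraphContourDeformation.lean`: for `Ψ` holomorphic on an open
`U ⊆ ℂ^{n+1}`, `φ : ℝ^{n+1} → ℝ` of class `C¹` with compact support, and the real slice together
with the graphs `w + iθφ(w)e₀`, `0 ≤ θ ≤ 1`, inside `U` (`e₀` the first basis vector),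

  `∫ w, (1 + i ∂₀φ(w)) • Ψ(w + iφ(w)e₀) = ∫ w, Ψ(w)`

(`integral_graph_deformation_firstCoord_eq`; real points enter through
`Literature.Analysis.FunctionSpaces.EuclideanSpace.complexify`). Proof: split off the first
coordinate (`ℝ^{n+1} ≃ ℝ × ℝⁿ`, Mathlib `MeasurableEquiv.piFinSuccAbove`, volume preserving),
Fubini, and the one-variable deformation `integral_graph_deformation_eq` on every line
`t ↦ (t, ω)`, where the profile is `g(t) = φ(t, ω)` and the holomorphic function of one
variable is `ζ ↦ Ψ(ζ, ω)`. The factor `1 + i ∂₀φ` is the Jacobian `det(1 + i ∇φ ⊗ e₀)` of the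
deformation. Unidirectional deformations in an arbitrary direction reduce to this one by a
rotation; they are the device continuing space potentials `∫ K(z - w) a(w) dw` analytically in
`z` when `a` is analytic near `Re z` only (Grujić–Kukavica 1998; Bradshaw–Grujić–Kukavica 2015).

## References

* Z. Grujić, I. Kukavica, J. Funct. Anal. 152 (1998) 447–466, §2. [GrujicKukavica1998]
* Z. Bradshaw, Z. Grujić, I. Kukavica, J. Differential Equations 259 (2015), §3.
  [BradshawGrujicKukavica2015]
-/

noncomputable section

open MeasureTheory Set Function Filter Metric
open _root_.Topology
open _root_.Complex (I)
open Literature.Analysis.FunctionSpaces.EuclideanSpace (complexify complexify_apply)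

namespace Literature.Analysis.Complex

variable {G : Type*} [NormedAddCommGroup G] [NormedSpace ℂ G] [CompleteSpace G]

/-! ### Coordinates: the complex line through `(·, ω)` -/

section Coordinates

variable {n : ℕ}

/-- The point of `ℂ^{n+1}` with first coordinate `ζ` and the real coordinates `ω` after it.
(Written inline as `WithLp.toLp 2 (Fin.cons ζ fun j => (ω j : ℂ))`; this lemma records its
coordinates.) [folklore] -/
theorem toLp_cons_apply_zero (ζ : ℂ) (ω : Fin n → ℝ) :
    (WithLp.toLp 2 (Fin.cons ζ (fun j => (ω j : ℂ)) : Fin (n + 1) → ℂ) :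
      EuclideanSpace ℂ (Fin (n + 1))) 0 = ζ := by
  simp

/-- Later coordinates of the same point. [folklore] -/
theorem toLp_cons_apply_succ (ζ : ℂ) (ω : Fin n → ℝ) (j : Fin n) :
    (WithLp.toLp 2 (Fin.cons ζ (fun j => (ω j : ℂ)) : Fin (n + 1) → ℂ) :
      EuclideanSpace ℂ (Fin (n + 1))) j.succ = (ω j : ℂ) := by
  simp

/-- **The deformed point in split coordinates**: for `w = (t, ω)`,
`cx w + I • cx ((c) • e₀)` is the point with first coordinate `t + ic` and coordinates `ω`
after it. [folklore] -/
theorem complexify_cons_add_I_smul_single (t c : ℝ) (ω : Fin n → ℝ) :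
    complexify (WithLp.toLp 2 (Fin.cons t ω : Fin (n + 1) → ℝ) : EuclideanSpace ℝ (Fin (n + 1))) +
        I • complexify (c • EuclideanSpace.single (0 : Fin (n + 1)) (1 : ℝ)) =
      (WithLp.toLp 2 (Fin.cons ((t : ℂ) + I * (c : ℂ)) (fun j => (ω j : ℂ)) : Fin (n + 1) → ℂ) :
        EuclideanSpace ℂ (Fin (n + 1))) := by
  ext i
  refine Fin.cases ?_ (fun j => ?_) i
  · simp [complexify_apply]
  · simp [complexify_apply, Fin.succ_ne_zero]

/-- The real point in split coordinates (`c = 0`). [folklore] -/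
theorem complexify_cons (t : ℝ) (ω : Fin n → ℝ) :
    complexify (WithLp.toLp 2 (Fin.cons t ω : Fin (n + 1) → ℝ) : EuclideanSpace ℝ (Fin (n + 1))) =
      (WithLp.toLp 2 (Fin.cons (t : ℂ) (fun j => (ω j : ℂ)) : Fin (n + 1) → ℂ) :
        EuclideanSpace ℂ (Fin (n + 1))) := by
  have h := complexify_cons_add_I_smul_single t 0 ω
  simpa using h

/-- The complex line `ζ ↦ (ζ, ω)` is an affine `ℂ`-differentiable map. [folklore] -/
theorem differentiable_toLp_cons (ω : Fin n → ℝ) :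
    Differentiable ℂ fun ζ : ℂ =>
      (WithLp.toLp 2 (Fin.cons ζ (fun j => (ω j : ℂ)) : Fin (n + 1) → ℂ) :
        EuclideanSpace ℂ (Fin (n + 1))) := by
  have h : (fun ζ : ℂ => (WithLp.toLp 2 (Fin.cons ζ (fun j => (ω j : ℂ)) : Fin (n + 1) → ℂ) :
      EuclideanSpace ℂ (Fin (n + 1)))) =
        fun ζ => ζ • EuclideanSpace.single (0 : Fin (n + 1)) (1 : ℂ) +
        (WithLp.toLp 2 (Fin.cons 0 (fun j => (ω j : ℂ)) : Fin (n + 1) → ℂ) :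
          EuclideanSpace ℂ (Fin (n + 1))) := by
    funext ζ
    ext i
    refine Fin.cases ?_ (fun j => ?_) i
    · simp
    · simp [Fin.succ_ne_zero]
  rw [h]
  fun_prop

/-- The real line `t ↦ (t, ω)` in `ℝ^{n+1}` is `t ↦ t • e₀ + (0, ω)`; its derivative is `e₀`.
[folklore] -/
theorem hasDerivAt_toLp_cons (ω : Fin n → ℝ) (t : ℝ) :
    HasDerivAt (fun t' : ℝ => (WithLp.toLp 2 (Fin.cons t' ω : Fin (n + 1) → ℝ) :
      EuclideanSpace ℝ (Fin (n + 1)))) (EuclideanSpace.single (0 : Fin (n + 1)) (1 : ℝ)) t := by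
  have h : (fun t' : ℝ => (WithLp.toLp 2 (Fin.cons t' ω : Fin (n + 1) → ℝ) :
      EuclideanSpace ℝ (Fin (n + 1)))) =
        fun t' => t' • EuclideanSpace.single (0 : Fin (n + 1)) (1 : ℝ) +
        (WithLp.toLp 2 (Fin.cons 0 ω : Fin (n + 1) → ℝ) : EuclideanSpace ℝ (Fin (n + 1))) := by
    funext t'
    ext i
    refine Fin.cases ?_ (fun j => ?_) i
    · simp
    · simp [Fin.succ_ne_zero]
  rw [h]
  simpa using
    ((hasDerivAt_id t).smul_const (EuclideanSpace.single (0 : Fin (n + 1)) (1 : ℝ))).add_const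
    (WithLp.toLp 2 (Fin.cons 0 ω : Fin (n + 1) → ℝ) : EuclideanSpace ℝ (Fin (n + 1)))

end Coordinates

/-! ### The deformation theorem along the first coordinate -/

/-- **Deformation of `ℝ^{n+1}` into a graph along the first coordinate.** Let `Ψ : ℂ^{n+1} → G` be
holomorphic on an open `U`, `φ : ℝ^{n+1} → ℝ` of class `C¹` with compact support, and assume the
graphs `cx w + iθφ(w) e₀`, `0 ≤ θ ≤ 1`, lie in `U`. If both integrands below are integrable, then
`∫ w, (1 + i ∂₀φ(w)) • Ψ(cx w + iφ(w)e₀) = ∫ w, Ψ(cx w)` (Fubini along the first axis and the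
one-variable deformation `integral_graph_deformation_eq` on each line). [folklore] -/
theorem integral_graph_deformation_firstCoord_eq {n : ℕ} {Ψ : EuclideanSpace ℂ (Fin (n + 1)) → G}
    {U : Set (EuclideanSpace ℂ (Fin (n + 1)))} (hU : IsOpen U) (hΨ : DifferentiableOn ℂ Ψ U)
    {φ : EuclideanSpace ℝ (Fin (n + 1)) → ℝ} (hφ : ContDiff ℝ 1 φ) (hφc : HasCompactSupport φ)
    (hsweep : ∀ w : EuclideanSpace ℝ (Fin (n + 1)), ∀ θ ∈ Icc (0 : ℝ) 1,
      complexify w +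
        I • complexify ((θ * φ w) • EuclideanSpace.single (0 : Fin (n + 1)) (1 : ℝ)) ∈ U)
    (hintL : Integrable fun w : EuclideanSpace ℝ (Fin (n + 1)) =>
      ((1 : ℂ) + I * ((fderiv ℝ φ w (EuclideanSpace.single 0 1) : ℝ) : ℂ)) •
        Ψ (complexify w + I • complexify (φ w • EuclideanSpace.single (0 : Fin (n + 1)) (1 : ℝ))))
    (hintR : Integrable fun w : EuclideanSpace ℝ (Fin (n + 1)) => Ψ (complexify w)) :
    ∫ w : EuclideanSpace ℝ (Fin (n + 1)),
        ((1 : ℂ) + I * ((fderiv ℝ φ w (EuclideanSpace.single 0 1) : ℝ) : ℂ)) •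
          Ψ (complexify w +
            I • complexify (φ w • EuclideanSpace.single (0 : Fin (n + 1)) (1 : ℝ))) =
      ∫ w : EuclideanSpace ℝ (Fin (n + 1)), Ψ (complexify w) := by
  -- split off the first coordinate
  set e : EuclideanSpace ℝ (Fin (n + 1)) ≃ᵐ ℝ × (Fin n → ℝ) :=
    (MeasurableEquiv.toLp 2 (Fin (n + 1) → ℝ)).symm.trans
      (MeasurableEquiv.piFinSuccAbove (fun _ => ℝ) 0) with he
  have hmp : MeasurePreserving e volume volume :=
    (EuclideanSpace.volume_preserving_symm_measurableEquiv_toLp (Fin (n + 1))).trans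
      (volume_preserving_piFinSuccAbove (fun _ => ℝ) 0)
  have hsymm : ∀ (t : ℝ) (ω : Fin n → ℝ),
      e.symm (t, ω) = (WithLp.toLp 2 (Fin.cons t ω : Fin (n + 1) → ℝ)) := by
    intro t ω
    apply e.injective
    rw [MeasurableEquiv.apply_symm_apply]
    simp [he, MeasurableEquiv.trans_apply, MeasurableEquiv.piFinSuccAbove_apply, Fin.cons_zero]
  -- the two integrands, transported to `ℝ × ℝⁿ`
  set L : EuclideanSpace ℝ (Fin (n + 1)) → G := fun w =>
    ((1 : ℂ) + I * ((fderiv ℝ φ w (EuclideanSpace.single 0 1) : ℝ) : ℂ)) •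
      Ψ (complexify w + I • complexify (φ w • EuclideanSpace.single (0 : Fin (n + 1)) (1 : ℝ)))
    with hL
  set R : EuclideanSpace ℝ (Fin (n + 1)) → G := fun w => Ψ (complexify w) with hR
  have hL' : Integrable (L ∘ e.symm) (volume : Measure (ℝ × (Fin n → ℝ))) :=
    hmp.symm.integrable_comp_emb e.symm.measurableEmbedding |>.2 hintL
  have hR' : Integrable (R ∘ e.symm) (volume : Measure (ℝ × (Fin n → ℝ))) :=
    hmp.symm.integrable_comp_emb e.symm.measurableEmbedding |>.2 hintR
  have htransL : ∫ w, L w = ∫ q : ℝ × (Fin n → ℝ), L (e.symm q) :=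
    (hmp.symm.integral_comp e.symm.measurableEmbedding L).symm
  have htransR : ∫ w, R w = ∫ q : ℝ × (Fin n → ℝ), R (e.symm q) :=
    (hmp.symm.integral_comp e.symm.measurableEmbedding R).symm
  -- Fubini: integrate in `t` first
  have hprodL : ∫ q : ℝ × (Fin n → ℝ), L (e.symm q) = ∫ ω : Fin n → ℝ, ∫ t : ℝ, L (e.symm (t, ω)) :=
    integral_prod_symm (fun q : ℝ × (Fin n → ℝ) => L (e.symm q)) hL'
  have hprodR : ∫ q : ℝ × (Fin n → ℝ), R (e.symm q) = ∫ ω : Fin n → ℝ, ∫ t : ℝ, R (e.symm (t, ω)) :=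
    integral_prod_symm (fun q : ℝ × (Fin n → ℝ) => R (e.symm q)) hR'
  rw [htransL, htransR, hprodL, hprodR]
  refine integral_congr_ae (Eventually.of_forall fun ω => ?_)
  -- the one-variable deformation on the line through `ω`
  have hgd : Differentiable ℝ φ := hφ.differentiable (by simp)
  set g : ℝ → ℝ := fun t => φ (WithLp.toLp 2 (Fin.cons t ω : Fin (n + 1) → ℝ)) with hg
  set F : ℂ → G := fun ζ => Ψ (WithLp.toLp 2 (Fin.cons ζ (fun j => (ω j : ℂ)) : Fin (n + 1) → ℂ))
    with hF
  have hline : ∀ t, HasDerivAt (fun t' : ℝ => (WithLp.toLp 2 (Fin.cons t' ω : Fin (n + 1) → ℝ) :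
      EuclideanSpace ℝ (Fin (n + 1)))) (EuclideanSpace.single (0 : Fin (n + 1)) (1 : ℝ)) t :=
    hasDerivAt_toLp_cons ω
  have hgderiv : ∀ t, deriv g t =
      fderiv ℝ φ (WithLp.toLp 2 (Fin.cons t ω)) (EuclideanSpace.single 0 1) := by
    intro t
    have h := ((hgd _).hasFDerivAt).comp_hasDerivAt t (hline t)
    exact h.deriv
  have hgC : ContDiff ℝ 1 g := by
    rw [hg]
    refine hφ.comp ?_
    have : (fun t : ℝ =>
        (WithLp.toLp 2 (Fin.cons t ω : Fin (n + 1) → ℝ) : EuclideanSpace ℝ (Fin (n + 1)))) =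
        fun t => t • EuclideanSpace.single (0 : Fin (n + 1)) (1 : ℝ) +
          (WithLp.toLp 2 (Fin.cons 0 ω : Fin (n + 1) → ℝ) : EuclideanSpace ℝ (Fin (n + 1))) := by
      funext t; ext i; refine Fin.cases ?_ (fun j => ?_) i
      · simp
      · simp [Fin.succ_ne_zero]
    rw [this]
    fun_prop
  have hgc : HasCompactSupport g := by
    -- `g = φ ∘ ℓ` with `ℓ` a proper (closed embedding, affine isometric) line
    rw [hg]
    refine hφc.comp_isClosedEmbedding ?_
    have hiso : Isometry fun t : ℝ => (WithLp.toLp 2 (Fin.cons t ω : Fin (n + 1) → ℝ) :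
        EuclideanSpace ℝ (Fin (n + 1))) := by
      refine Isometry.of_dist_eq fun t t' => ?_
      rw [EuclideanSpace.dist_eq, Fin.sum_univ_succ]
      simp [Real.dist_eq, Real.sqrt_sq_eq_abs]
    exact hiso.isClosedEmbedding
  -- the line lies in `U` along the sweep
  set V : Set ℂ := {ζ | (WithLp.toLp 2 (Fin.cons ζ (fun j => (ω j : ℂ)) : Fin (n + 1) → ℂ) :
      EuclideanSpace ℂ (Fin (n + 1))) ∈ U} with hV
  have hVopen : IsOpen V := hU.preimage (differentiable_toLp_cons ω).continuous
  have hFdiff : DifferentiableOn ℂ F V := hΨ.comp (differentiable_toLp_cons ω).differentiableOn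
    fun ζ hζ => hζ
  have hsweepV : ∀ t : ℝ, ∀ θ ∈ Icc (0 : ℝ) 1, ((t : ℂ) + I * ((θ * g t : ℝ) : ℂ)) ∈ V := by
    intro t θ hθ
    have h := hsweep (WithLp.toLp 2 (Fin.cons t ω)) θ hθ
    rwa [complexify_cons_add_I_smul_single] at h
  have key := integral_graph_deformation_eq hVopen hFdiff hgC hgc hsweepV
  -- identify the integrands
  have hLt : ∀ t, L (e.symm (t, ω)) = ((1 : ℂ) + I * ((deriv g t : ℝ) : ℂ)) •
      F ((t : ℂ) + I * ((g t : ℝ) : ℂ)) := by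
    intro t
    rw [hsymm, hgderiv]
    simp only [hL, hF, hg]
    rw [complexify_cons_add_I_smul_single]
  have hRt : ∀ t, R (e.symm (t, ω)) = F (t : ℂ) := by
    intro t
    rw [hsymm]
    simp only [hR, hF]
    rw [complexify_cons]
  simp only [hLt, hRt]
  exact key

end Literature.Analysis.Complex

end
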